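/-
Copyright: H21 programme, solo seat `solo-RiemannHypothesis-informed` (session 4).
-/
import Summits.RiemannHypothesis.RiemannHypothesis.Theorems.SoloInformedDecay
import Summits.RiemannHypothesis.RiemannHypothesis.Theorems.SoloInformedZeroSide

/-!
# Unconditional sampling-energy bound for window tests (solo-informed, T9)

For a Weil test `h` supported in `[-a, a]` (`a ≥ 0`) and a height `γ₀`, the twisted window test
`g(t) = h(t) e^{−iγ₀t}` has `ĝ(ρ) = ĥ(ρ − iγ₀)`.  The decay estimates of `SoloInformedDecay`
(orders `0` and `1`) give, for every `ρ` in the closed critical strip `0 ≤ Re ρ ≤ 1`,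

`|ĝ(ρ)|² ≤ e^{a} (‖h‖₁² + ‖h′‖₁²) / (1 + (Im ρ − γ₀)²)`,

and the zero-side bookkeeping of `SoloInformedZeroSide` turns this Cauchy majorant into the
**unconditional** bound, uniform in the truncation height `T`,

`∑_{ρ ∈ weilZeroIndex T} m(ρ) |ĝ(ρ)|² ≤ 2 A₁ e^{a} (‖h‖₁² + ‖h′‖₁²) log(|γ₀| + 2)`,

with the absolute constant `A₁` of `Montgomery.exists_density_le`.  This discharges the
hypothesis `B` of the visibility inequalities (`SoloInformedGroundStateDipole`,
`SoloInformedDodging`) by an explicit quantity: see `weilGroundEnergy_le_explicit_of_oddDipole`.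
The factor `e^{a}` is the price of possible zeros anywhere in the closed strip; it is what a
hypothesis-free argument cannot avoid (paper §4, (D6′)(v)).

Main results: `norm_sq_weilMellin_twist_le_kernel`, `exists_weilSamplingEnergy_le`,
`weilGroundEnergy_le_explicit_of_oddDipole`.
-/

open MeasureTheory Complex Set Filter Topology Literature.NumberTheory.LFunctions
open scoped ContDiff

namespace Summit.RiemannHypothesis.RiemannHypothesis.Theorems

/-- **Pointwise Cauchy majorant.** For a Weil test `h` with `tsupport h ⊆ [-a, a]`, `a ≥ 0`,
and `ρ` with `0 ≤ Re ρ ≤ 1`: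
`|ĝ(ρ)|² ≤ e^{a}(‖h‖₁² + ‖h′‖₁²)/(1 + (Im ρ − γ₀)²)` for `g = h·e^{−iγ₀t}`. -/
theorem norm_sq_weilMellin_twist_le_kernel {h : ℝ → ℂ} (hh : IsWeilTest h) {a : ℝ} (ha : 0 ≤ a)
    (hhs : tsupport h ⊆ Icc (-a) a) (γ₀ : ℝ) {ρ : ℂ} (hρ0 : 0 ≤ ρ.re) (hρ1 : ρ.re ≤ 1) :
    ‖weilMellin (fun t ↦ h t * cexp (-(γ₀ * I) * t)) ρ‖ ^ 2
      ≤ Real.exp a * ((∫ t : ℝ, ‖h t‖) ^ 2 + (∫ t : ℝ, ‖deriv h t‖) ^ 2)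
          / (1 + (ρ.im - γ₀) ^ 2) := by
  rw [weilMellin_mul_cexp]
  set s : ℂ := ρ + -(γ₀ * I) with hs
  set X : ℝ := ‖weilMellin h s‖ with hX
  set A : ℝ := ∫ t : ℝ, ‖h t‖ with hA
  set B : ℝ := ∫ t : ℝ, ‖deriv h t‖ with hB
  have hsre : s.re = ρ.re := by simp [hs]
  have hsim : (s - 1 / 2).im = ρ.im - γ₀ := by simp [hs]; ring
  have hexp : Real.exp (|s.re - 1 / 2| * a) ≤ Real.exp (a / 2) := by
    apply Real.exp_le_exp.mpr
    have : |s.re - 1 / 2| ≤ 1 / 2 := by rw [hsre]; exact abs_le.mpr ⟨by linarith, by linarith⟩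
    nlinarith
  have hA0 : 0 ≤ A := integral_nonneg fun t ↦ norm_nonneg _
  have hB0 : 0 ≤ B := integral_nonneg fun t ↦ norm_nonneg _
  -- order 0
  have h0 := norm_weilMellin_le_of_isWeilTest hh hhs 0 s
  simp only [pow_zero, one_mul, iteratedDeriv_zero] at h0
  have hX0 : X ≤ Real.exp (a / 2) * A := h0.trans (mul_le_mul_of_nonneg_right hexp hA0)
  -- order 1
  have h1 := norm_weilMellin_le_of_isWeilTest hh hhs 1 s
  simp only [pow_one, iteratedDeriv_one] at h1
  have hX1 : |ρ.im - γ₀| * X ≤ Real.exp (a / 2) * B := by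
    have him : |ρ.im - γ₀| ≤ ‖s - 1 / 2‖ := by rw [← hsim]; exact Complex.abs_im_le_norm _
    calc |ρ.im - γ₀| * X ≤ ‖s - 1 / 2‖ * X := mul_le_mul_of_nonneg_right him (norm_nonneg _)
      _ ≤ Real.exp (|s.re - 1 / 2| * a) * B := h1
      _ ≤ Real.exp (a / 2) * B := mul_le_mul_of_nonneg_right hexp hB0
  have hXnn : 0 ≤ X := norm_nonneg _
  have hE : Real.exp (a / 2) ^ 2 = Real.exp a := by
    rw [← Real.exp_nat_mul]; congr 1; ring
  have hsq0 : X ^ 2 ≤ Real.exp a * A ^ 2 := by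
    have := pow_le_pow_left₀ hXnn hX0 2
    rw [mul_pow, hE] at this
    exact this
  have hsq1 : (ρ.im - γ₀) ^ 2 * X ^ 2 ≤ Real.exp a * B ^ 2 := by
    have := pow_le_pow_left₀ (by positivity) hX1 2
    rw [mul_pow, sq_abs, mul_pow, hE] at this
    exact this
  have hpos : 0 < 1 + (ρ.im - γ₀) ^ 2 := by positivity
  rw [le_div_iff₀ hpos]
  nlinarith

/-- **Unconditional sampling-energy bound (T9).** There is an absolute constant `A₁ > 0` such
that for every Weil test `h` with `tsupport h ⊆ [-a, a]`, `a ≥ 0`, every height `γ₀` and every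
truncation height `T`:
`∑_{ρ ∈ weilZeroIndex T} m(ρ) |ĝ(ρ)|² ≤ 2 A₁ e^{a} (‖h‖₁² + ‖h′‖₁²) log(|γ₀| + 2)`,
`g = h·e^{−iγ₀t}`. -/
theorem exists_weilSamplingEnergy_le :
    ∃ A₁ : ℝ, 0 < A₁ ∧ ∀ (h : ℝ → ℂ) (a γ₀ : ℝ), IsWeilTest h → 0 ≤ a →
      tsupport h ⊆ Icc (-a) a → ∀ T : ℝ,
        ∑ᶠ ρ ∈ weilZeroIndex T, (riemannZetaZeroOrder ρ : ℝ) *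
            ‖weilMellin (fun t ↦ h t * cexp (-(γ₀ * I) * t)) ρ‖ ^ 2
          ≤ 2 * A₁ * (Real.exp a * ((∫ t : ℝ, ‖h t‖) ^ 2 + (∫ t : ℝ, ‖deriv h t‖) ^ 2))
              * Real.log (|γ₀| + 2) := by
  obtain ⟨A₁, hA₁, hK⟩ := exists_finsum_weilZeroIndex_le_of_kernel_bound
  refine ⟨A₁, hA₁, fun h a γ₀ hh ha hhs T ↦ ?_⟩
  have hM : 0 ≤ Real.exp a * ((∫ t : ℝ, ‖h t‖) ^ 2 + (∫ t : ℝ, ‖deriv h t‖) ^ 2) := by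
    positivity
  exact hK (fun ρ ↦ ‖weilMellin (fun t ↦ h t * cexp (-(γ₀ * I) * t)) ρ‖ ^ 2) _ γ₀ hM
    (fun ρ h0 h1 ↦ norm_sq_weilMellin_twist_le_kernel hh ha hhs γ₀ h0 h1) T

/-- **Explicit visibility inequality (T10 = T5 ∘ T7 ∘ T9).** With the absolute constant `A₁`
of `exists_weilSamplingEnergy_le`: for an odd Weil test `h` supported in `[-a, a]` (`a ≥ 0`),
a real dodging ordinate `τ` with `k = D_τ h ≠ 0` in `L²`, and a zero `ρ₀ = ½ + η + iγ₀` of `ζ`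
with `|η| ≤ ½`, `γ₀ ≠ 0`, the ground-state defect of the window `[-a, a]` satisfies
`ε(a) · ‖k‖₂² ≤ 2A₁ e^{a}(‖k‖₁² + ‖k′‖₁²) log(|γ₀|+2) − 4 m(ρ₀) (η² + τ²)² |∫ h e^{ηt}|²`.
Every quantity on the right is explicit; no hypothesis on the other zeros is made. -/
theorem weilGroundEnergy_le_explicit_of_oddDipole :
    ∃ A₁ : ℝ, 0 < A₁ ∧ ∀ (h : ℝ → ℂ) (a τ η γ₀ : ℝ), IsWeilTest h → (∀ t, h (-t) = -h t) →
      0 ≤ a → tsupport h ⊆ Icc (-a) a → 0 < ∫ t, ‖weilDodge τ h t‖ ^ 2 →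
      riemannZeta (1 / 2 + η + γ₀ * I) = 0 → |η| ≤ 1 / 2 → γ₀ ≠ 0 →
        weilGroundEnergy a ≤
          (2 * A₁ * (Real.exp a * ((∫ t : ℝ, ‖weilDodge τ h t‖) ^ 2
                + (∫ t : ℝ, ‖deriv (weilDodge τ h) t‖) ^ 2)) * Real.log (|γ₀| + 2)
            - 4 * ((riemannZetaZeroOrder (1 / 2 + η + γ₀ * I) : ℝ)
                * ((η ^ 2 + τ ^ 2) ^ 2 * ‖∫ t : ℝ, h t * cexp ((η : ℂ) * t)‖ ^ 2)))
            / ∫ t, ‖weilDodge τ h t‖ ^ 2 := by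
  obtain ⟨A₁, hA₁, hS⟩ := exists_weilSamplingEnergy_le
  refine ⟨A₁, hA₁, fun h a τ η γ₀ hh hodd ha hhs hpos hζ hη hγ ↦ ?_⟩
  have hk : IsWeilTest (weilDodge τ h) := isWeilTest_weilDodge hh τ
  have hks : tsupport (weilDodge τ h) ⊆ Icc (-a) a := (tsupport_weilDodge_subset τ h).trans hhs
  exact weilGroundEnergy_le_of_oddDipole_weilDodge hh hodd hhs τ hpos hζ hη hγ
    (hS (weilDodge τ h) a γ₀ hk ha hks)

end Summit.RiemannHypothesis.RiemannHypothesis.Theorems
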